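import Mathlib.Analysis.Convex.SpecificFunctions.Basic
import Mathlib.Analysis.Convex.Slope
import Mathlib.Analysis.SpecialFunctions.Pow.Real
import Literature.Probability.RandomPlanarGeometry.EllipticKBasic
import HarnessLib

/-!
# Convexity of the complete elliptic integral `K(u)` in the parameter

Topic `Literature/Analysis/SpecialFunctions`. The tree's complete elliptic integral of the first kind
`ellipticK u = ∫₀¹ dt/√((1-t²)(1-u t²))` (parameter convention, `RectangleModulus.lean`; basic theory in
`EllipticKBasic.lean`: monotone and continuous on `(-∞, 1)`, `K(0) = π/2`, logarithmic divergence at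
`u → 1⁻`) is a **convex** function of the parameter on `(-∞, 1)`: for each `t ∈ [0, 1)` the integrand
`u ↦ (1-t²)^{-1/2} (1-u t²)^{-1/2}` is the convex decreasing power `x ↦ x^{-1/2}` of an affine function
of `u`, and convexity integrates. We record

* `convexOn_rpow_of_nonpos` — `x ↦ x ^ p` is convex on `(0, ∞)` for every `p ≤ 0` (Mathlib's
  `convexOn_rpow` covers `p ≥ 1` on `[0, ∞)` and `convexOn_zpow` integer exponents; here
  `x ^ p = exp (p log x)` with `log` concave, `p ≤ 0`, `exp` convex increasing);
* `convexOn_ellIntegrand` — for `t² < 1`, `u ↦ ellIntegrand u t` is convex on `(-∞, 1)`;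
* `convexOn_ellipticK` — **`K` is convex on `(-∞, 1)`**;
* `ellipticK_le_chord` — the chord bound `K(u) ≤ ((u₁-u) K(u₀) + (u-u₀) K(u₁))/(u₁-u₀)` for
  `u₀ ≤ u ≤ u₁ < 1`, `u₀ < u₁` (the form used to tabulate certified upper envelopes of `K` between
  grid points; the matching lower envelope is `ellipticK_mono`);
* `ellipticK_secant_mono_left` / `ellipticK_secant_mono_right` — inside a grid cell every difference
  quotient of `K` lies between the two neighbouring tabulated secant slopes (derivative-free
  replacement for `dK/dm` in mean-value quadrature forms).

Classical: `K` is a positive combination of the completely monotone functions `u ↦ (1 - u t²)^{-1/2}`,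
hence absolutely monotone on `(-∞, 1)`; equivalently all Maclaurin coefficients of
`K(u) = (π/2) ₂F₁(½,½;1;u)` are positive (Borwein–Borwein (1.3.6)). Only convexity is proved here.

## References
* [BorweinBorwein1987] J. M. Borwein, P. B. Borwein, *Pi and the AGM*, Wiley (1987), §1.3.
* [AbramowitzStegun1964] M. Abramowitz, I. Stegun, *Handbook of Mathematical Functions* (1964), 17.3.11.
* [BoydVandenberghe2004] S. Boyd, L. Vandenberghe, *Convex Optimization*, CUP (2004), §3.1.5.
-/

noncomputable section

open Real _root_.MeasureTheory _root_.Set _root_.Filter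
open scoped _root_.Topology
open Literature.Probability.RandomPlanarGeometry

namespace Literature.Analysis.SpecialFunctions

/-! ### Convexity of negative powers -/

/-- For `p ≤ 0` the power function `x ↦ x ^ p` is convex on `(0, ∞)`:
`(a x + b y)^p = exp(p log(a x + b y)) ≤ exp(p (a log x + b log y)) ≤ a x^p + b y^p`
(`log` concave, `p ≤ 0`, `exp` monotone and convex). Boyd–Vandenberghe, *Convex Optimization*,
§3.1.5 ("Powers: `x^a` is convex on `ℝ₊₊` when `a ≥ 1` or `a ≤ 0`"). [cite: BoydVandenberghe2004, §3.1.5] -/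
theorem convexOn_rpow_of_nonpos {p : ℝ} (hp : p ≤ 0) : ConvexOn ℝ (Ioi 0) fun x : ℝ => x ^ p := by
  refine ⟨convex_Ioi 0, fun x hx y hy a b ha hb hab => ?_⟩
  have hx : 0 < x := hx
  have hy : 0 < y := hy
  have hxy : 0 < a • x + b • y := (convex_Ioi (0 : ℝ)) hx hy ha hb hab
  have hlog : a • Real.log x + b • Real.log y ≤ Real.log (a • x + b • y) :=
    strictConcaveOn_log_Ioi.concaveOn.2 hx hy ha hb hab
  have hexp : Real.exp (a • (Real.log x * p) + b • (Real.log y * p))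
      ≤ a • Real.exp (Real.log x * p) + b • Real.exp (Real.log y * p) :=
    convexOn_exp.2 (mem_univ _) (mem_univ _) ha hb hab
  simp only [smul_eq_mul] at hxy hlog hexp ⊢
  rw [rpow_def_of_pos hxy, rpow_def_of_pos hx, rpow_def_of_pos hy]
  refine le_trans (Real.exp_le_exp.2 ?_) hexp
  have : Real.log (a * x + b * y) * p ≤ (a * Real.log x + b * Real.log y) * p :=
    mul_le_mul_of_nonpos_right hlog hp
  linarith

/-- `1/√x = x^{-1/2}` for `x ≥ 0`. [folklore] -/
private theorem oneDivSqrt_eq_rpow_negHalf {x : ℝ} (hx : 0 ≤ x) : 1 / Real.sqrt x = x ^ (-(1 / 2 : ℝ)) := by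
  rw [Real.sqrt_eq_rpow, Real.rpow_neg hx, one_div]

/-- `x ↦ 1/√x` is convex on `(0, ∞)` (the case `a = -1/2` of Boyd–Vandenberghe §3.1.5).
[cite: BoydVandenberghe2004, §3.1.5] -/
theorem convexOn_one_div_sqrt : ConvexOn ℝ (Ioi 0) fun x : ℝ => 1 / Real.sqrt x :=
  (convexOn_rpow_of_nonpos (p := -(1 / 2 : ℝ)) (by norm_num)).congr fun x hx =>
    (oneDivSqrt_eq_rpow_negHalf (le_of_lt hx)).symm

/-! ### Convexity of the integrand and of `K` -/

/-- For fixed `t` with `t² < 1`, the elliptic integrand `u ↦ 1/√((1-t²)(1-u t²))` is convex in the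
parameter on `(-∞, 1)` (there the radicand is positive and affine in `u`): the pointwise input of
the convexity of `K(m) = (π/2)[1 + (1/2)²m + (1·3/2·4)²m² + ⋯]`. [cite: AbramowitzStegun1964, 17.3.11] -/
theorem convexOn_ellIntegrand {t : ℝ} (ht : t ^ 2 < 1) :
    ConvexOn ℝ (Iio 1) fun u : ℝ => ellIntegrand u t := by
  refine ⟨convex_Iio 1, fun u hu v hv a b ha hb hab => ?_⟩
  have hu : u < 1 := hu
  have hv : v < 1 := hv
  have hc : 0 < 1 - t ^ 2 := by linarith
  have ht0 : 0 ≤ t ^ 2 := sq_nonneg t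
  have hx : 0 < (1 - t ^ 2) * (1 - u * t ^ 2) := mul_pos hc (by nlinarith)
  have hy : 0 < (1 - t ^ 2) * (1 - v * t ^ 2) := mul_pos hc (by nlinarith)
  have key := convexOn_one_div_sqrt.2 hx hy ha hb hab
  simp only [smul_eq_mul] at key ⊢
  unfold ellIntegrand
  have e : (1 - t ^ 2) * (1 - (a * u + b * v) * t ^ 2)
      = a * ((1 - t ^ 2) * (1 - u * t ^ 2)) + b * ((1 - t ^ 2) * (1 - v * t ^ 2)) := by
    have hb' : b = 1 - a := by linarith
    rw [hb']; ring
  rw [e]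
  exact key

/-- A convex combination of parameters `< 1` is `< 1`. [folklore] -/
private theorem convexCombo_lt_one {u v a b : ℝ} (hu : u < 1) (hv : v < 1) (ha : 0 ≤ a) (hb : 0 ≤ b)
    (hab : a + b = 1) : a * u + b * v < 1 := by
  have h := (convex_Iio (1 : ℝ)) (show u ∈ Iio (1:ℝ) from hu) (show v ∈ Iio (1:ℝ) from hv) ha hb hab
  simpa [smul_eq_mul] using h

/-- **The complete elliptic integral `K(u) = ∫₀¹ dt/√((1-t²)(1-u t²))` is convex on `(-∞, 1)`.**
Proof: integrate the pointwise convexity `convexOn_ellIntegrand` over `t ∈ [0, 1]` (at `t = 1` the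
integrand takes the junk value `0` for every parameter). On `[0, 1)` this is visible from the
Maclaurin series with positive coefficients `K(m) = (π/2)[1 + (1/2)²m + (1·3/2·4)²m² + ⋯]`
(Abramowitz–Stegun 17.3.11; Borwein–Borwein §1.3); the integral proof here covers all `u < 1`.
[cite: AbramowitzStegun1964, 17.3.11] -/
theorem convexOn_ellipticK : ConvexOn ℝ (Iio 1) ellipticK := by
  refine ⟨convex_Iio 1, fun u hu v hv a b ha hb hab => ?_⟩
  have hu : u < 1 := hu
  have hv : v < 1 := hv
  simp only [smul_eq_mul]
  have huv : a * u + b * v < 1 := convexCombo_lt_one hu hv ha hb hab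
  have hiu := intervalIntegrable_ellIntegrand_of_lt_one hu
  have hiv := intervalIntegrable_ellIntegrand_of_lt_one hv
  have hiuv := intervalIntegrable_ellIntegrand_of_lt_one huv
  rw [ellipticK_eq, ellipticK_eq, ellipticK_eq]
  calc ∫ t in (0:ℝ)..1, ellIntegrand (a * u + b * v) t
      ≤ ∫ t in (0:ℝ)..1, (a * ellIntegrand u t + b * ellIntegrand v t) := by
        refine intervalIntegral.integral_mono_on zero_le_one hiuv
          ((hiu.const_mul a).add (hiv.const_mul b)) fun t ht => ?_
        rcases lt_or_eq_of_le ht.2 with h1 | h1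
        · have ht2 : t ^ 2 < 1 := by nlinarith [ht.1]
          have key := (convexOn_ellIntegrand ht2).2 (show u ∈ Iio (1:ℝ) from hu)
            (show v ∈ Iio (1:ℝ) from hv) ha hb hab
          simpa [smul_eq_mul] using key
        · subst h1
          simp [ellIntegrand]
    _ = a * (∫ t in (0:ℝ)..1, ellIntegrand u t) + b * (∫ t in (0:ℝ)..1, ellIntegrand v t) := by
        rw [intervalIntegral.integral_add (hiu.const_mul a) (hiv.const_mul b),
          intervalIntegral.integral_const_mul, intervalIntegral.integral_const_mul]

/-- **Chord bound.** For `u₀ < u₁ < 1` and `u ∈ [u₀, u₁]`,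
`K(u) ≤ ((u₁ - u) K(u₀) + (u - u₀) K(u₁)) / (u₁ - u₀)`: between two tabulated parameters the
certified upper envelope of `K` is the chord (convexity), the lower envelope is `K(u₀)`
(`ellipticK_mono`). Corollary of `convexOn_ellipticK`. [cite: AbramowitzStegun1964, 17.3.11] -/
theorem ellipticK_le_chord {u₀ u₁ u : ℝ} (h₀₁ : u₀ < u₁) (hu₁ : u₁ < 1) (h₀ : u₀ ≤ u) (h₁ : u ≤ u₁) :
    ellipticK u ≤ ((u₁ - u) * ellipticK u₀ + (u - u₀) * ellipticK u₁) / (u₁ - u₀) := by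
  have hd : 0 < u₁ - u₀ := sub_pos.2 h₀₁
  have hu₀ : u₀ < 1 := h₀₁.trans hu₁
  set a := (u₁ - u) / (u₁ - u₀) with ha_def
  set b := (u - u₀) / (u₁ - u₀) with hb_def
  have ha : 0 ≤ a := div_nonneg (sub_nonneg.2 h₁) hd.le
  have hb : 0 ≤ b := div_nonneg (sub_nonneg.2 h₀) hd.le
  have hab : a + b = 1 := by
    rw [ha_def, hb_def, ← add_div, div_eq_one_iff_eq hd.ne']; ring
  have hcomb : a * u₀ + b * u₁ = u := by
    rw [ha_def, hb_def]; field_simp; ring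
  have key := convexOn_ellipticK.2 (show u₀ ∈ Iio (1:ℝ) from hu₀) (show u₁ ∈ Iio (1:ℝ) from hu₁)
    ha hb hab
  simp only [smul_eq_mul, hcomb] at key
  calc ellipticK u ≤ a * ellipticK u₀ + b * ellipticK u₁ := key
    _ = ((u₁ - u) * ellipticK u₀ + (u - u₀) * ellipticK u₁) / (u₁ - u₀) := by
        rw [ha_def, hb_def]; field_simp

/-! ### Secant (difference-quotient) envelopes -/

/-- **Lower secant envelope.** For `v < u₀ < u < 1` the difference quotient of `K` over `[u₀, u]`
dominates the tabulated secant slope over `[v, u₀]`: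
`(K u₀ - K v)/(u₀ - v) ≤ (K u - K u₀)/(u - u₀)`, i.e.
`K u ≥ K u₀ + (u - u₀)·(K u₀ - K v)/(u₀ - v)` — the derivative-free lower envelope of `K` to the
right of a grid point (convexity, `ConvexOn.secant_mono`). [cite: AbramowitzStegun1964, 17.3.11] -/
theorem ellipticK_secant_mono_left {v u₀ u : ℝ} (h₁ : v < u₀) (h₂ : u₀ < u) (hu : u < 1) :
    (ellipticK u₀ - ellipticK v) / (u₀ - v) ≤ (ellipticK u - ellipticK u₀) / (u - u₀) := by
  have h := convexOn_ellipticK.secant_mono (a := u₀) (x := v) (y := u)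
    (show u₀ ∈ Iio (1:ℝ) from h₂.trans hu) (show v ∈ Iio (1:ℝ) from h₁.trans (h₂.trans hu))
    (show u ∈ Iio (1:ℝ) from hu) (ne_of_lt h₁) (ne_of_gt h₂) (h₁.trans h₂).le
  rwa [← neg_div_neg_eq, neg_sub, neg_sub] at h

/-- **Upper secant envelope.** For `u₀ < u ≤ w < 1`:
`(K u - K u₀)/(u - u₀) ≤ (K w - K u₀)/(w - u₀)`, i.e. `K u ≤ K u₀ + (u - u₀)·(K w - K u₀)/(w - u₀)`
(the chord; cf. `ellipticK_le_chord`). Together with `ellipticK_secant_mono_left`, every difference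
quotient of `K` inside a grid cell `[u₀, w]` lies between the two neighbouring tabulated secant
slopes — the certified replacement for `dK/dm` in mean-value quadrature forms.
[cite: AbramowitzStegun1964, 17.3.11] -/
theorem ellipticK_secant_mono_right {u₀ u w : ℝ} (h₁ : u₀ < u) (h₂ : u ≤ w) (hu : w < 1) :
    (ellipticK u - ellipticK u₀) / (u - u₀) ≤ (ellipticK w - ellipticK u₀) / (w - u₀) :=
  convexOn_ellipticK.secant_mono (a := u₀) (x := u) (y := w)
    (show u₀ ∈ Iio (1:ℝ) from h₁.trans (lt_of_le_of_lt h₂ hu))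
    (show u ∈ Iio (1:ℝ) from lt_of_le_of_lt h₂ hu) (show w ∈ Iio (1:ℝ) from hu)
    (ne_of_gt h₁) (ne_of_gt (lt_of_lt_of_le h₁ h₂)) h₂

/-! ### Four-point secant monotonicity (appended 2026-08-27, eng g5)

For a K-table (`Literature/Analysis/ValidatedNumerics/EllipticKTable.lean`) every difference
quotient of `K` inside a grid cell is bracketed by the tabulated secants of the NEIGHBOURING cells;
the two halves of that statement, as corollaries of `convexOn_ellipticK`. -/

/-- **Four-point secant monotonicity, left half.** If `x₁ < x₂ ≤ u < v < 1` then
`(K x₂ - K x₁)/(x₂ - x₁) ≤ (K v - K u)/(v - u)` (anchor `x₁`, then anchor `v`, in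
`ConvexOn.secant_mono`). [cite: AbramowitzStegun1964, 17.3.11] -/
theorem ellipticK_secant_le_secant_of_le {x₁ x₂ u v : ℝ} (h₁₂ : x₁ < x₂) (h₂u : x₂ ≤ u)
    (huv : u < v) (hv : v < 1) :
    (ellipticK x₂ - ellipticK x₁) / (x₂ - x₁) ≤ (ellipticK v - ellipticK u) / (v - u) := by
  have hu1 : u < 1 := huv.trans hv
  have hx2 : x₂ < 1 := lt_of_le_of_lt h₂u hu1
  have hx1 : x₁ < 1 := h₁₂.trans hx2
  have hx1v : x₁ < v := h₁₂.trans_le (h₂u.trans huv.le)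
  have hx1u : x₁ < u := h₁₂.trans_le h₂u
  have s1 : (ellipticK x₂ - ellipticK x₁) / (x₂ - x₁) ≤
      (ellipticK v - ellipticK x₁) / (v - x₁) :=
    convexOn_ellipticK.secant_mono (a := x₁) (x := x₂) (y := v)
      (show x₁ ∈ Iio (1:ℝ) from hx1) (show x₂ ∈ Iio (1:ℝ) from hx2)
      (show v ∈ Iio (1:ℝ) from hv) (ne_of_gt h₁₂) (ne_of_gt hx1v) (h₂u.trans huv.le)
  have s2 : (ellipticK x₁ - ellipticK v) / (x₁ - v) ≤ (ellipticK u - ellipticK v) / (u - v) :=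
    convexOn_ellipticK.secant_mono (a := v) (x := x₁) (y := u)
      (show v ∈ Iio (1:ℝ) from hv) (show x₁ ∈ Iio (1:ℝ) from hx1)
      (show u ∈ Iio (1:ℝ) from hu1) (ne_of_lt hx1v) (ne_of_lt huv) hx1u.le
  rw [← neg_div_neg_eq, neg_sub, neg_sub] at s2
  rw [show (ellipticK u - ellipticK v) / (u - v) = (ellipticK v - ellipticK u) / (v - u) by
    rw [← neg_div_neg_eq, neg_sub, neg_sub]] at s2
  exact s1.trans s2

/-- **Four-point secant monotonicity, right half.** If `u < v ≤ x₃ < x₄ < 1` then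
`(K v - K u)/(v - u) ≤ (K x₄ - K x₃)/(x₄ - x₃)`. [cite: AbramowitzStegun1964, 17.3.11] -/
theorem ellipticK_secant_le_secant_of_ge {u v x₃ x₄ : ℝ} (huv : u < v) (hv₃ : v ≤ x₃)
    (h₃₄ : x₃ < x₄) (hx₄ : x₄ < 1) :
    (ellipticK v - ellipticK u) / (v - u) ≤ (ellipticK x₄ - ellipticK x₃) / (x₄ - x₃) := by
  have hx3 : x₃ < 1 := h₃₄.trans hx₄
  have hv1 : v < 1 := lt_of_le_of_lt hv₃ hx3
  have hu1 : u < 1 := huv.trans hv1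
  have hux4 : u < x₄ := huv.trans (hv₃.trans_lt h₃₄)
  have hux3 : u ≤ x₃ := huv.le.trans hv₃
  have s1 : (ellipticK v - ellipticK u) / (v - u) ≤
      (ellipticK x₄ - ellipticK u) / (x₄ - u) :=
    convexOn_ellipticK.secant_mono (a := u) (x := v) (y := x₄)
      (show u ∈ Iio (1:ℝ) from hu1) (show v ∈ Iio (1:ℝ) from hv1)
      (show x₄ ∈ Iio (1:ℝ) from hx₄) (ne_of_gt huv) (ne_of_gt hux4) (hv₃.trans h₃₄.le)
  have s2 : (ellipticK u - ellipticK x₄) / (u - x₄) ≤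
      (ellipticK x₃ - ellipticK x₄) / (x₃ - x₄) :=
    convexOn_ellipticK.secant_mono (a := x₄) (x := u) (y := x₃)
      (show x₄ ∈ Iio (1:ℝ) from hx₄) (show u ∈ Iio (1:ℝ) from hu1)
      (show x₃ ∈ Iio (1:ℝ) from hx3) (ne_of_lt hux4) (ne_of_lt h₃₄) hux3
  rw [← neg_div_neg_eq, neg_sub, neg_sub] at s2
  rw [show (ellipticK x₃ - ellipticK x₄) / (x₃ - x₄) =
      (ellipticK x₄ - ellipticK x₃) / (x₄ - x₃) by
    rw [← neg_div_neg_eq, neg_sub, neg_sub]] at s2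
  exact s1.trans s2

end Literature.Analysis.SpecialFunctions

end
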